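import Summits.PneNP.PneNP.Theorems.NegLimitedAmplifiedWindowBaseA
import Mathlib
import HarnessLib

/-!
# Amplified critical window — base helper (b): the per-rung inequality `RungStep`
(cell pnp-ideate, rung F-N1/p3, ROUND-11; line `amplified-window` on item stmt-PneNP-19860, stub B
`CriticalWindowHardness`; typed statement `RungStep` of `Theorems/NegLimitedAmplifiedWindowBaseDefs.lean`
= pnp-ideate-p3 r11/base-helpers.lean, referee-approved prover target (ref g24 SCORE-R11, 20:18Z))

`rungStep_holds : RungStep` — for ANY Boolean graph function `g` obeying the pointwise relative
sparse-noise bound `Pr_A[g(x ∪ K_A)] ≤ θ + Pr_{y∼G(n,q)}[g(x ∪ y)]` (the shape of the conclusion of the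
tree's `thm1_sparse_relative`) and any second-moment bound `E_p[N_k²] ≤ M`, with `λ = C(n,k)p^{C(k,2)} > 0`:

  `1 − (√M/λ)·√(err_p) ≤ θ + π(p ⊕ q) + err_{p ⊕ q}`,

`err_r = Pr_{G(n,r)}[g ≠ CLIQUE_k]`, `π(r) = Pr_{G(n,r)}[CLIQUE_k]`, `p ⊕ q = p + q − pq`.

Proof.  Average the pointwise bound over `x ∼ G(n,p)`.  ABOVE: `E_x Pr_y[g(x ∪ y)] = Pr_{p⊕q}[g]`
(union law `sum_sum_gnpWeight_mul_sup`) and `[g = 1] ≤ [CLIQUE] + [g ≠ CLIQUE]`.  BELOW: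
`E_x Pr_A[g(x ∪ K_A)] = E_p[N_k·g]/λ` (`sizeBiasIdentity_holds`), `E_p[N_k] = λ` (the same identity with
`F = 1`), and `E_p[N_k·(1−g)] ≤ E_p[N_k·1_{g ≠ CLIQUE}] ≤ √(E_p N_k²)·√(err_p)` (`N_k ≥ 1 ∧ g = 0 ⇒
g ≠ CLIQUE_k`; Cauchy–Schwarz `sum_sq_le_sum_mul_sum_of_sq_le_mul`).

HONEST FRAMING: an elementary averaging / Cauchy–Schwarz inequality, one input of the OPEN stub B; no
hardness is proved; FRONTIER rung F-N1 — nothing here bears on P vs NP.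
-/

set_option linter.dupNamespace false -- `Summit.PneNP.PneNP.…`: summit = sub-problem name (D-0017 single-conjunct layout)

namespace Summit.PneNP.PneNP.Theorems.NegLimitedDoor.AmplifiedWindowBase

open Finset
open Literature.Computability.Complexity

/-! ### Small helpers -/

/-- First moment: `E_{G(n,p)}[N_k] = C(n,k)·p^{C(k,2)}` (the size-bias identity with `F = 1`). -/
theorem sum_gnpWeight_mul_cliqueCount (n k : ℕ) (p : ℝ) :
    ∑ x, gnpWeight n p x * (cliqueCount n k x : ℝ) = (n.choose k : ℝ) * p ^ k.choose 2 := by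
  classical
  have h := sizeBiasIdentity_holds n k p (fun _ => 1)
  simp only [mul_one, sum_gnpWeight, sum_const, card_powersetCard, card_univ, Fintype.card_fin,
    nsmul_eq_mul] at h
  rw [← h]
  ring

/-! ### The rung step -/

/-- **`RungStep` holds**: `1 − (√M/λ)·√(err_p) ≤ θ + π(p ⊕ q) + err_{p ⊕ q}`. -/
theorem rungStep_holds : RungStep := by
  classical
  intro n k p q θ M g hp0 hp1 hq0 hq1 hlam hM hpt hsec
  -- shorthands (as plain hypotheses, no new definitions)
  have hw0 : ∀ x, 0 ≤ gnpWeight n p x := fun x => gnpWeight_nonneg hp0 hp1 x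
  have hs0 : 0 ≤ p + q - p * q := by nlinarith [mul_nonneg (sub_nonneg.2 hp1) hq0]
  have hs1 : p + q - p * q ≤ 1 := by nlinarith [mul_nonneg (sub_nonneg.2 hp1) (sub_nonneg.2 hq1)]
  have hw'0 : ∀ z, 0 ≤ gnpWeight n (p + q - p * q) z := fun z => gnpWeight_nonneg hs0 hs1 z
  have hCpos : (0 : ℝ) < n.choose k := by
    rcases (Nat.cast_nonneg (α := ℝ) (n.choose k)).eq_or_lt with h | h
    · exfalso; rw [← h, zero_mul] at hlam; exact lt_irrefl _ hlam
    · exact h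
  have hppos : 0 < p ^ k.choose 2 := by
    rcases (pow_nonneg hp0 (k.choose 2)).eq_or_lt with h | h
    · exfalso; rw [← h, mul_zero] at hlam; exact lt_irrefl _ hlam
    · exact h
  -- ### ABOVE: averaging the sparse-noise side
  have hA : ∑ x, gnpWeight n p x * kSubsetProb n k (fun A => g (x ⊔ cliqueVec A) = true) ≤
      θ + ∑ z, gnpWeight n (p + q - p * q) z * (if g z = true then (1 : ℝ) else 0) := by
    calc ∑ x, gnpWeight n p x * kSubsetProb n k (fun A => g (x ⊔ cliqueVec A) = true)
        ≤ ∑ x, gnpWeight n p x * (θ + gnpProb n q (univ.filter fun y => g (x ⊔ y) = true)) :=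
          sum_le_sum fun x _ => mul_le_mul_of_nonneg_left (hpt x) (hw0 x)
      _ = θ * ∑ x, gnpWeight n p x +
            ∑ x, ∑ y, gnpWeight n p x * gnpWeight n q y * (if g (x ⊔ y) = true then (1 : ℝ) else 0) := by
          rw [mul_sum, ← sum_add_distrib]
          refine sum_congr rfl fun x _ => ?_
          rw [gnpProb_filter, mul_add, mul_comm (gnpWeight n p x) θ, mul_sum]
          congr 1
          refine sum_congr rfl fun y _ => ?_
          split_ifs <;> ring
      _ = θ + ∑ z, gnpWeight n (p + q - p * q) z * (if g z = true then (1 : ℝ) else 0) := by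
          rw [sum_gnpWeight, mul_one,
            sum_sum_gnpWeight_mul_sup p q (fun z => if g z = true then (1 : ℝ) else 0)]
  have hA' : ∑ z, gnpWeight n (p + q - p * q) z * (if g z = true then (1 : ℝ) else 0) ≤
      gnpProb n (p + q - p * q) (univ.filter fun x => cliqueFn n k x = true) +
        gnpProb n (p + q - p * q) (univ.filter fun x => g x ≠ cliqueFn n k x) := by
    rw [gnpProb_filter, gnpProb_filter, ← sum_add_distrib]
    refine sum_le_sum fun z _ => ?_
    have hz := hw'0 z
    cases g z <;> cases cliqueFn n k z <;> simp
    all_goals linarith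
  -- ### BELOW: the planted side is `E[N_k·g]/λ`
  have hB : ∑ x, gnpWeight n p x * kSubsetProb n k (fun A => g (x ⊔ cliqueVec A) = true) =
      (∑ x, gnpWeight n p x * ((cliqueCount n k x : ℝ) * (if g x = true then (1 : ℝ) else 0))) /
        ((n.choose k : ℝ) * p ^ k.choose 2) := by
    have hsb := sizeBiasIdentity_holds n k p (fun z => if g z = true then (1 : ℝ) else 0)
    have hks : ∀ x, kSubsetProb n k (fun A => g (x ⊔ cliqueVec A) = true) =
        (∑ A ∈ powersetCard k (univ : Finset (Fin n)),
          (if g (x ⊔ cliqueVec A) = true then (1 : ℝ) else 0)) / (n.choose k : ℝ) := by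
      intro x
      unfold kSubsetProb
      rw [sum_boole]
    have hswap : ∑ x, gnpWeight n p x *
        ((∑ A ∈ powersetCard k (univ : Finset (Fin n)),
          (if g (x ⊔ cliqueVec A) = true then (1 : ℝ) else 0)) / (n.choose k : ℝ)) =
        (∑ A ∈ powersetCard k (univ : Finset (Fin n)),
          ∑ x, gnpWeight n p x * (if g (x ⊔ cliqueVec A) = true then (1 : ℝ) else 0)) /
          (n.choose k : ℝ) := by
      rw [sum_comm, sum_div]
      refine sum_congr rfl fun x _ => ?_
      rw [mul_div_assoc', mul_sum]
    rw [sum_congr rfl fun x _ => by rw [hks x], hswap, ← hsb,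
      mul_comm ((n.choose k : ℕ) : ℝ) (p ^ k.choose 2), mul_div_mul_left _ _ hppos.ne']
  -- ### BELOW: first moment, the `(1 − g)`-part and Cauchy–Schwarz
  have hfirst := sum_gnpWeight_mul_cliqueCount n k p
  have hsplit : ∑ x, gnpWeight n p x * ((cliqueCount n k x : ℝ) * (if g x = true then (1 : ℝ) else 0)) =
      (n.choose k : ℝ) * p ^ k.choose 2 -
        ∑ x, gnpWeight n p x * ((cliqueCount n k x : ℝ) * (if g x = true then (0 : ℝ) else 1)) := by
    rw [← hfirst, eq_sub_iff_add_eq, ← sum_add_distrib]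
    refine sum_congr rfl fun x _ => ?_
    split_ifs <;> ring
  have hbad : ∑ x, gnpWeight n p x * ((cliqueCount n k x : ℝ) * (if g x = true then (0 : ℝ) else 1)) ≤
      ∑ x, gnpWeight n p x *
        ((cliqueCount n k x : ℝ) * (if g x ≠ cliqueFn n k x then (1 : ℝ) else 0)) := by
    refine sum_le_sum fun x _ => mul_le_mul_of_nonneg_left ?_ (hw0 x)
    by_cases h0 : cliqueCount n k x = 0
    · simp [h0]
    · have hcl : cliqueFn n k x = true := (cliqueCount_ne_zero_iff x).1 h0
      refine mul_le_mul_of_nonneg_left ?_ (Nat.cast_nonneg _)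
      cases g x <;> simp [hcl]
  have herr : gnpProb n p (univ.filter fun x => g x ≠ cliqueFn n k x) =
      ∑ x, gnpWeight n p x * (if g x ≠ cliqueFn n k x then (1 : ℝ) else 0) := by
    rw [gnpProb_filter]
    refine sum_congr rfl fun x _ => ?_
    split_ifs <;> simp
  have hCS : ∑ x, gnpWeight n p x *
        ((cliqueCount n k x : ℝ) * (if g x ≠ cliqueFn n k x then (1 : ℝ) else 0)) ≤
      Real.sqrt M * Real.sqrt (gnpProb n p (univ.filter fun x => g x ≠ cliqueFn n k x)) := by
    have hsq : (∑ x, gnpWeight n p x *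
        ((cliqueCount n k x : ℝ) * (if g x ≠ cliqueFn n k x then (1 : ℝ) else 0))) ^ 2 ≤
        (∑ x, gnpWeight n p x * (cliqueCount n k x : ℝ) ^ 2) *
          ∑ x, gnpWeight n p x * (if g x ≠ cliqueFn n k x then (1 : ℝ) else 0) := by
      refine sum_sq_le_sum_mul_sum_of_sq_le_mul univ
        (fun x _ => mul_nonneg (hw0 x) (sq_nonneg _))
        (fun x _ => mul_nonneg (hw0 x) (by split_ifs <;> norm_num)) fun x _ => le_of_eq ?_
      split_ifs <;> ring
    have hM' : ∑ x, gnpWeight n p x * (cliqueCount n k x : ℝ) ^ 2 ≤ M := hsec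
    have hprod_nonneg : 0 ≤ ∑ x, gnpWeight n p x * (cliqueCount n k x : ℝ) ^ 2 :=
      sum_nonneg fun x _ => mul_nonneg (hw0 x) (sq_nonneg _)
    calc ∑ x, gnpWeight n p x *
          ((cliqueCount n k x : ℝ) * (if g x ≠ cliqueFn n k x then (1 : ℝ) else 0))
        ≤ Real.sqrt ((∑ x, gnpWeight n p x * (cliqueCount n k x : ℝ) ^ 2) *
            ∑ x, gnpWeight n p x * (if g x ≠ cliqueFn n k x then (1 : ℝ) else 0)) :=
          (le_abs_self _).trans (Real.abs_le_sqrt hsq)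
      _ = Real.sqrt (∑ x, gnpWeight n p x * (cliqueCount n k x : ℝ) ^ 2) *
            Real.sqrt (∑ x, gnpWeight n p x * (if g x ≠ cliqueFn n k x then (1 : ℝ) else 0)) :=
          Real.sqrt_mul hprod_nonneg _
      _ ≤ Real.sqrt M * Real.sqrt (gnpProb n p (univ.filter fun x => g x ≠ cliqueFn n k x)) := by
          rw [← herr]
          exact mul_le_mul_of_nonneg_right (Real.sqrt_le_sqrt hM') (Real.sqrt_nonneg _)
  -- ### assemble
  have hlow : (n.choose k : ℝ) * p ^ k.choose 2 -
      Real.sqrt M * Real.sqrt (gnpProb n p (univ.filter fun x => g x ≠ cliqueFn n k x)) ≤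
      ∑ x, gnpWeight n p x * ((cliqueCount n k x : ℝ) * (if g x = true then (1 : ℝ) else 0)) := by
    rw [hsplit]
    linarith
  have hchain : (∑ x, gnpWeight n p x * ((cliqueCount n k x : ℝ) * (if g x = true then (1 : ℝ) else 0))) /
        ((n.choose k : ℝ) * p ^ k.choose 2) ≤
      θ + gnpProb n (p + q - p * q) (univ.filter fun x => cliqueFn n k x = true) +
        gnpProb n (p + q - p * q) (univ.filter fun x => g x ≠ cliqueFn n k x) := by
    rw [← hB]
    linarith
  refine le_trans ?_ hchain
  rw [le_div_iff₀ hlam]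
  have e : (1 - Real.sqrt M / ((n.choose k : ℝ) * p ^ k.choose 2) *
        Real.sqrt (gnpProb n p (univ.filter fun x => g x ≠ cliqueFn n k x))) *
      ((n.choose k : ℝ) * p ^ k.choose 2) =
      (n.choose k : ℝ) * p ^ k.choose 2 -
        Real.sqrt M * Real.sqrt (gnpProb n p (univ.filter fun x => g x ≠ cliqueFn n k x)) := by
    field_simp
  rw [e]
  exact hlow

end Summit.PneNP.PneNP.Theorems.NegLimitedDoor.AmplifiedWindowBase
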